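import Summits.Parity.GeneralizedHardyLittlewood.Theorems.LeeYangFibresCellParityLawDefs
import Summits.Parity.GeneralizedHardyLittlewood.Theorems.LeeYangFibresCellParityLawSingularRatio
import Literature.NumberTheory.Sieve.LinearEquationsInPrimesSubsystems
import Literature.NumberTheory.Sieve.ParityWalshSections
import HarnessLib

/-!
# Route `LeeYangFibres`, crux `CellParityLaw` (stmt-Parity-14109), line `section-annihilator`:
# the registered stub `stub_walshStep` — the Walsh / tensor induction step

We prove `WalshStep` (vocabulary file `LeeYangFibresCellParityLawDefs`): given the anatomy bounds
`ModelDensityBounds` (`a_m ≤ C/log N`, `a_m ≥ c/log N` on the bulk `1 ≤ m < u`, `a_u = 0`) and the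
singular-series bookkeeping `SingularRatioBound` (`𝔖, 𝔖₋ᵢ ≥ 0`, `𝔖 ≤ C_s (log log N)^D 𝔖₋ᵢ`), the
section law `SectionLawAt t` for `(t+1)`-form systems and the effective cell-parity law `LawEffAt t`
for `t`-form systems give `LawEffAt (t+1)`.

Proof (pure bookkeeping; budgets `E_B = N/(log^{t+1} N (log log N)^B)`). Fix `L, u, B` and a
`(t+1)`-form system `Ψ` of size `≤ L` with a convex body `K ⊆ [-N,N]`.

1. *Coordinate estimate.* For a coordinate `i`, the fibre mass
   `F⁽ⁱ⁾_{j'} = sectionMass Ψ K N u i j' 1` IS the joint cell count of the sub-system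
   `Ψ₋ᵢ = Fin.removeNth i Ψ` over the convex half-body `K ∩ {ψ_i > 0}`
   (`sectionMass_one_eq_cell`), whose archimedean factor is `β_∞(Ψ, K)`
   (`archFactor_removeNth_inter`) and whose size is `≤ L` (`affLinSize_removeNth_le`); so the
   induction hypothesis at budget `B + 1 + D` prices it by a Walsh polynomial `W_{θ⁽ⁱ⁾}(j')`.
   Feeding this into the section law at budget `B + 1` (`(𝔖/𝔖₋ᵢ) · 𝔖₋ᵢ = 𝔖`, `a_m ≤ C/log N`,
   `𝔖/𝔖₋ᵢ ≤ C_s (log log N)^D`; `ParityWalsh.abs_sub_main_le_of_section`) gives, for all `i`,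
   `j' ∈ [1,u]^t`, `m ∈ [1,u]`:
   `C(j' with m at i) = (1 + (δ_{i,j'}-1)(-1)^m) W_{θ⁽ⁱ⁾}(j') · β_∞ 𝔖 · a_m ∏_k a_{j'_k}`
   `+ O((2CC_s+1) E_{B+1})`.
2. *Assembly.* The Literature theorem `ParityWalsh.exists_walshSum_of_sections` (tensor flattening:
   Dirac coefficients for small mass `β_∞ 𝔖`; else normalisation by `β_∞ 𝔖 ∏ a`, chain over the
   coordinates, Walsh–Fourier inversion on the cube of parity patterns with the empty coefficient
   pinned to `1` by the mean identity `λ(1) + λ(2) = 2`, positivity for `|θ_S| ≤ 2`, `u = 2`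
   separately, top cells from `a_u = 0`) turns these `(t+1) u^t` section estimates into the
   parity-vector law with error `2^{t+3} (C/c)^{t+1} (2CC_s+1) E_{B+1} ≤ E_B` once
   `log log N ≥ 2^{t+3} (C/c)^{t+1} (2CC_s+1)`.

No number theory is used beyond the four hypotheses.

References: E. Bombieri, *The asymptotic sieve*, Rend. Accad. Naz. XL (5) 1/2 (1975/76) 243–269
[BombieriAsymptoticSieve1976]; B. Green, T. Tao, Ann. of Math. 171 (2010), Def. 1.1, (1.1), (1.4)
[GreenTao2010].
-/

noncomputable section

open scoped BigOperators Classical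
open Finset Filter Literature.NumberTheory.Sieve

namespace Summit.Parity.GeneralizedHardyLittlewood.Cruxes.CellParityLaw.SectionAnnihilator

namespace WalshStepAux

/-- **The half-body identity** (content (i) of the Walsh step): the fibre mass at `d = 1` of the
`i`-th section IS the joint cell count of the sub-system `Ψ₋ᵢ` over the convex half-body
`K ∩ {ψ_i > 0}` (same lattice filter: `1 ∣ ψ_i(n)` is vacuous, `ψ_i(n) > 0` is membership of the
real point in `{ψ_i > 0}`, and `Fin.removeNth i Ψ k = Ψ (i.succAbove k)`). -/
theorem sectionMass_one_eq_cell {t : ℕ} (Ψ : Fin (t + 1) → AffLinForm 1) (K : Set (Fin 1 → ℝ))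
    (N u : ℕ) (i : Fin (t + 1)) (j' : Fin t → ℕ) :
    sectionMass Ψ K N u i j' 1 =
      cell (Fin.removeNth i Ψ) (K ∩ {x | 0 < (Ψ i).realEval x}) N u j' := by
  -- adapted from the refuter probe `ProbeSectionAnnihilator.Probe.sectionMass_one_eq_cell`
  unfold sectionMass cell
  congr 1
  ext n
  have hcast : (Ψ i).realEval (realPoint n) = (((Ψ i).eval n : ℤ) : ℝ) :=
    AffLinForm.realEval_intCast (Ψ i) n
  simp only [Finset.mem_filter, Set.mem_inter_iff, Set.mem_setOf_eq, hcast, Int.cast_pos,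
    Nat.cast_one, one_dvd, true_and, Fin.removeNth_apply]
  tauto

/-- `a_m ≥ 0` (a count divided by `N`). -/
theorem modelDensity_nonneg (N u m : ℕ) : 0 ≤ modelDensity N u m :=
  div_nonneg (Nat.cast_nonneg _) (Nat.cast_nonneg _)

/-- `|1 + (δ - 1)(-1)^m| ≤ 2` for `δ ∈ [0, 2]`. -/
theorem abs_parityWeight_le {δ : ℝ} (h0 : 0 ≤ δ) (h2 : δ ≤ 2) (m : ℕ) :
    |1 + (δ - 1) * (-1 : ℝ) ^ m| ≤ 2 := by
  rcases neg_one_pow_eq_or ℝ m with h | h <;> rw [h, abs_le] <;> constructor <;> linarith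

/-- The budget arithmetic of the step: with `ℓ = log N`, `ℓℓ = log log N`,
`2^{t+3} ((C/ℓ)/(c/ℓ))^{t+1} · (E_{B+1} + 2 (C/ℓ)(C_s ℓℓ^D) E'_{B+1+D}) ≤ E_B` as soon as
`ℓℓ ≥ 2^{t+3} (C/c)^{t+1} (2 C C_s + 1)`, where `E_B = N/(ℓ^{t+1} ℓℓ^B)`, `E'_B = N/(ℓ^t ℓℓ^B)`. -/
theorem budget_le {t B D : ℕ} {N ℓ ℓℓ c C Cs : ℝ} (hℓ : 0 < ℓ) (hℓℓ : 0 < ℓℓ) (hc : 0 < c)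
    (hN : 0 ≤ N) (hbig : 2 ^ (t + 3) * (C / c) ^ (t + 1) * (2 * C * Cs + 1) ≤ ℓℓ) :
    2 ^ (t + 3) * ((C / ℓ) / (c / ℓ)) ^ (t + 1) *
        (N / (ℓ ^ (t + 1) * ℓℓ ^ (B + 1)) +
          2 * (C / ℓ) * (Cs * ℓℓ ^ D) * (N / (ℓ ^ t * ℓℓ ^ (B + 1 + D))))
      ≤ N / (ℓ ^ (t + 1) * ℓℓ ^ B) := by
  have hℓ' : ℓ ≠ 0 := hℓ.ne'
  have hℓℓ' : ℓℓ ≠ 0 := hℓℓ.ne'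
  have hc' : c ≠ 0 := hc.ne'
  have h1 : (C / ℓ) / (c / ℓ) = C / c := by field_simp
  have h2 : 2 * (C / ℓ) * (Cs * ℓℓ ^ D) * (N / (ℓ ^ t * ℓℓ ^ (B + 1 + D))) =
      2 * C * Cs * (N / (ℓ ^ (t + 1) * ℓℓ ^ (B + 1))) := by
    field_simp
    ring
  rw [h1, h2]
  have hX : 0 ≤ N / (ℓ ^ (t + 1) * ℓℓ ^ (B + 1)) := by positivity
  calc 2 ^ (t + 3) * (C / c) ^ (t + 1) *
        (N / (ℓ ^ (t + 1) * ℓℓ ^ (B + 1)) + 2 * C * Cs * (N / (ℓ ^ (t + 1) * ℓℓ ^ (B + 1))))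
      = (2 ^ (t + 3) * (C / c) ^ (t + 1) * (2 * C * Cs + 1)) *
          (N / (ℓ ^ (t + 1) * ℓℓ ^ (B + 1))) := by
        ring
    _ ≤ ℓℓ * (N / (ℓ ^ (t + 1) * ℓℓ ^ (B + 1))) := mul_le_mul_of_nonneg_right hbig hX
    _ = N / (ℓ ^ (t + 1) * ℓℓ ^ B) := by
        field_simp
        ring

/-- From `exp (exp K) ≤ N`: `log N > 0`, and `K ≤ log log N`. -/
theorem le_loglog_of_exp_exp_le {K : ℝ} {N : ℕ} (h : ⌈Real.exp (Real.exp K)⌉₊ ≤ N) :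
    0 < Real.log N ∧ K ≤ Real.log (Real.log N) := by
  have hN : Real.exp (Real.exp K) ≤ N := (Nat.le_ceil _).trans (by exact_mod_cast h)
  have hNpos : (0 : ℝ) < N := lt_of_lt_of_le (Real.exp_pos _) hN
  have hlog : Real.exp K ≤ Real.log N := (Real.le_log_iff_exp_le hNpos).mpr hN
  have hlogpos : 0 < Real.log N := lt_of_lt_of_le (Real.exp_pos _) hlog
  exact ⟨hlogpos, (Real.le_log_iff_exp_le hlogpos).mpr hlog⟩

end WalshStepAux

open WalshStepAux SingularRatio in
/-- **`stub_walshStep`** (registered stub of the line `section-annihilator`): the Walsh / tensor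
induction step `WalshStep` — anatomy bounds + singular-series bookkeeping + the section law for
`(t+1)`-form systems + the effective law for `t`-form systems ⟹ the effective law for
`(t+1)`-form systems. Budgets: section law at `B + 1`, induction hypothesis at `B + 1 + D`;
threshold `log log N ≥ 2^{t+3} (C/c)^{t+1} (2 C C_s + 1)`. -/
theorem stub_walshStep : WalshStep := by
  intro hDens hSing t _ht hSec hIH L u B hu
  obtain ⟨c, C, hc, hC, N₁, hN₁⟩ := hDens u hu
  obtain ⟨Cs, hCs, D, N₂, hN₂⟩ := hSing t L
  obtain ⟨N₃, hN₃⟩ := hSec L u (B + 1) hu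
  obtain ⟨N₄, hN₄⟩ := hIH L u (B + 1 + D) hu
  refine ⟨max (max (max N₁ N₂) (max N₃ N₄))
    ⌈Real.exp (Real.exp (max 1 (2 ^ (t + 3) * (C / c) ^ (t + 1) * (2 * C * Cs + 1))))⌉₊, ?_⟩
  intro N hN Ψ hΨ hL K hK hKN
  -- unpacking `N ≥ N₀`
  have hN' : max (max N₁ N₂) (max N₃ N₄) ≤ N := le_trans (le_max_left _ _) hN
  have hN₁N : N₁ ≤ N := le_trans (le_trans (le_max_left _ _) (le_max_left _ _)) hN'
  have hN₂N : N₂ ≤ N := le_trans (le_trans (le_max_right _ _) (le_max_left _ _)) hN'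
  have hN₃N : N₃ ≤ N := le_trans (le_trans (le_max_left _ _) (le_max_right _ _)) hN'
  have hN₄N : N₄ ≤ N := le_trans (le_trans (le_max_right _ _) (le_max_right _ _)) hN'
  obtain ⟨hℓ, hbig'⟩ := le_loglog_of_exp_exp_le (le_trans (le_max_right _ _) hN)
  have hℓℓ : 0 < Real.log (Real.log N) := lt_of_lt_of_le one_pos ((le_max_left _ _).trans hbig')
  have hbig : 2 ^ (t + 3) * (C / c) ^ (t + 1) * (2 * C * Cs + 1) ≤ Real.log (Real.log N) :=
    (le_max_right _ _).trans hbig'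
  -- the four hypotheses at `N`
  obtain ⟨hdens_le, hdens_ge, hdens_top⟩ := hN₁ N hN₁N
  have hsing := hN₂ N hN₂N Ψ hΨ hL
  have hIHi : ∀ i : Fin (t + 1), ∃ θ : Finset (Fin t) → ℝ, θ ∅ = 1 ∧ (∀ S, |θ S| ≤ 2) ∧
      ∀ j' : Fin t → ℕ, (∀ k, 1 ≤ j' k ∧ j' k ≤ u) →
        |(cell (Fin.removeNth i Ψ) (K ∩ {x | 0 < (Ψ i).realEval x}) N u j' : ℝ) -
            walsh θ j' * (archFactor (Fin.removeNth i Ψ) (K ∩ {x | 0 < (Ψ i).realEval x}) *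
              singularProduct (Fin.removeNth i Ψ) * ∏ k, modelDensity N u (j' k))|
          ≤ (N : ℝ) / (Real.log N ^ t * Real.log (Real.log N) ^ (B + 1 + D)) := fun i =>
    hN₄ N hN₄N (Fin.removeNth i Ψ) (isNondegenerateSystem_removeNth hΨ i)
      ((affLinSize_removeNth_le Ψ i N).trans hL) _ (convex_inter_realEval_pos (Ψ i) hK)
      (Set.inter_subset_left.trans hKN)
  choose θ' hθ'0 hθ'b hθ' using hIHi
  have hδi : ∀ (i : Fin (t + 1)) (j' : Fin t → ℕ), ∃ δ : ℝ, 0 ≤ δ ∧ δ ≤ 2 ∧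
      ((∀ k, 1 ≤ j' k ∧ j' k ≤ u) → ∀ m : ℕ, 1 ≤ m → m ≤ u →
        |(cell Ψ K N u (i.insertNth m j') : ℝ) -
            (1 + (δ - 1) * (-1 : ℝ) ^ m) * modelDensity N u m *
              (singularProduct Ψ / singularProduct (Fin.removeNth i Ψ)) *
                (sectionMass Ψ K N u i j' 1 : ℝ)|
          ≤ (N : ℝ) / (Real.log N ^ (t + 1) * Real.log (Real.log N) ^ (B + 1))) := by
    intro i j'
    by_cases hj' : ∀ k, 1 ≤ j' k ∧ j' k ≤ u
    · obtain ⟨δ, h0, h2, h⟩ := hN₃ N hN₃N Ψ hΨ hL K hK hKN i j' hj'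
      exact ⟨δ, h0, h2, fun _ => h⟩
    · exact ⟨1, zero_le_one, one_le_two, fun h => absurd h hj'⟩
  choose δ hδ0 hδ2 hδ using hδi
  -- Step 1: the coordinate estimate
  have hsec : ∀ (i : Fin (t + 1)) (j' : Fin t → ℕ), (∀ k, 1 ≤ j' k ∧ j' k ≤ u) →
      ∀ m : ℕ, 1 ≤ m → m ≤ u →
        |(cell Ψ K N u (i.insertNth m j') : ℝ) - (1 + (δ i j' - 1) * (-1 : ℝ) ^ m) *
            (∑ S, θ' i S * ∏ k ∈ S, (-1 : ℝ) ^ (j' k + 1)) *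
              (archFactor Ψ K * singularProduct Ψ) *
                (modelDensity N u m * ∏ k, modelDensity N u (j' k))|
          ≤ (N : ℝ) / (Real.log N ^ (t + 1) * Real.log (Real.log N) ^ (B + 1)) +
              2 * (C / Real.log N) * (Cs * Real.log (Real.log N) ^ D) *
                ((N : ℝ) / (Real.log N ^ t * Real.log (Real.log N) ^ (B + 1 + D))) := by
    intro i j' hj' m hm1 hmu
    have h1 := hδ i j' hj' m hm1 hmu
    have h2 := hθ' i j' hj'
    rw [← sectionMass_one_eq_cell Ψ K N u i j', archFactor_removeNth_inter] at h2
    obtain ⟨hSi, hS, hratio⟩ := hsing i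
    have hRS : singularProduct Ψ / singularProduct (Fin.removeNth i Ψ) *
        singularProduct (Fin.removeNth i Ψ) = singularProduct Ψ := by
      by_cases h0 : singularProduct (Fin.removeNth i Ψ) = 0
      · rw [h0, mul_zero] at hratio
        rw [h0, mul_zero]
        exact le_antisymm hS hratio
      · exact div_mul_cancel₀ _ h0
    have hR0 : 0 ≤ singularProduct Ψ / singularProduct (Fin.removeNth i Ψ) := div_nonneg hS hSi
    have hRB : singularProduct Ψ / singularProduct (Fin.removeNth i Ψ) ≤
        Cs * Real.log (Real.log N) ^ D := by
      by_cases h0 : singularProduct (Fin.removeNth i Ψ) = 0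
      · rw [h0, div_zero]; positivity
      · rw [div_le_iff₀ (lt_of_le_of_ne hSi (Ne.symm h0))]
        exact hratio
    exact ParityWalsh.abs_sub_main_le_of_section h1 h2 hRS
      (abs_parityWeight_le (hδ0 i j') (hδ2 i j') m) (modelDensity_nonneg N u m) (hdens_le m)
      hR0 hRB
  -- Step 2: the tensor law from the section laws, and the budget
  obtain ⟨θ, hθ0, hθb, hθ⟩ := ParityWalsh.exists_walshSum_of_sections (n := t) hu
    (C := fun j => (cell Ψ K N u j : ℝ)) (fun j => Nat.cast_nonneg _)
    (a := modelDensity N u) (am := c / Real.log N) (aM := C / Real.log N) (div_pos hc hℓ)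
    (modelDensity_nonneg N u) hdens_le hdens_ge (hdens_top u le_rfl)
    (M := archFactor Ψ K * singularProduct Ψ)
    (mul_nonneg (archFactor_nonneg Ψ K) (hsing 0).2.1) hθ'0 hθ'b (δ := δ)
    (fun i j' => ⟨hδ0 i j', hδ2 i j'⟩) hsec
  refine ⟨θ, hθ0, hθb, fun j hj => (hθ j hj).trans ?_⟩
  exact budget_le hℓ hℓℓ hc (Nat.cast_nonneg N) hbig

end Summit.Parity.GeneralizedHardyLittlewood.Cruxes.CellParityLaw.SectionAnnihilator

end
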